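import Literature.Topology.FourManifolds.TubeFromFraming
import Literature.Topology.FourManifolds.HomotopySpheresStablyParallelizable
import Literature.Topology.FourManifolds.StableFramingLift
import Literature.Topology.FourManifolds.Spin
import Mathlib.Geometry.Manifold.MFDeriv.Tangent
import Mathlib.Analysis.Calculus.ContDiff.Operations
import HarnessLib

/-!
# Frames of the tangent bundle along a map: readings, and smoothing a continuous frame

Topic `Literature/Topology/FourManifolds` (infrastructure for the fact seat of
`Literature.Topology.FourManifolds.HomotopySphere.exists_highlyConnected_of_mem_signatureSet`,
brick B8-F: the normal framing of an embedded sphere in an s-parallelizable manifold, Kosinski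
X.(2.1) / Kervaire–Milnor Lemma 5.3, first half).  For a map `e : S → V` into a `C^∞` manifold
`V` charted on its model vector space `E'` we consider **frames of `TV` along `e`** in the form
used by the tree's tubular-neighbourhood construction (`TubeFromFraming.lean`): families
`T u : E' →L[ℝ] E'` of linear maps into `T_{e u} V = E'` (read in the preferred chart at `e u`),
bijective at every `u`.  Their readings in a chart at `p` are `frameIn e T p u`
(`= tangentCoordChange (e u) p (e u) ∘ T u`), and `IsSmoothAlong` asks for smooth readings.

* `continuousOn_frameIn_of_continuous_totalSpaceMk` — a field of linear maps into the tangent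
  spaces which is continuous into Mathlib's `TangentBundle` (column by column) has continuous
  readings (push-forward along the chart, `ContinuousOn.totalSpaceMk_mfderiv`).
* `exists_frame_along_of_isParallelizable` — a parallelisation of `V` gives a bijective frame
  along any continuous `e`, continuous into `TV`.
* `contMDiffOn_tangentCoordChange_comp` — the derivative cocycle `tangentCoordChange p q (e u)`
  is `C^∞` in `u` where `e u` lies in both chart domains (Mathlib's
  `contDiffOn_fderiv_coord_change`).
* `exists_isSmoothAlong_frame` — **smoothing a continuous frame along a map from a compact
  manifold** (Steenrod, *The Topology of Fibre Bundles* (1951), §6.7: a continuous cross-section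
  of a smooth bundle can be approximated by a smooth one; Hirsch, *Differential Topology* (1976),
  Ch. 4 §3, Thm. 3.3 / Ch. 2 §2): if the readings of `T` are continuous and every `T u` is
  bijective, there is `T'` with `IsSmoothAlong e T'` and every `T' u` bijective.  Proof: a finite
  smooth partition of unity `ρ` on `S` subordinate to the preimages of chart domains at
  `p a = e a`; smooth approximations `S a` of the cut-off readings in these charts
  (`Continuous.exists_contMDiff_approx`); `T' u = Σ ρ a u • tangentCoordChange (p a) (e u) (e u) ∘ S a u`;
  smoothness of the readings by the cocycle rule `tangentCoordChange_comp`, bijectivity because in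
  the chart at `p b` on the compact `tsupport (ρ b)` the reading of `T'` is uniformly close to
  that of `T`, and invertible maps form an open set (`ContinuousLinearEquiv.isOpen`).

Everything is proved; no definitions, no named facts.

## References

* N. Steenrod, *The Topology of Fibre Bundles*, Princeton (1951), §6.7. [Steenrod1951]
* M. W. Hirsch, *Differential Topology*, GTM 33 (1976), Ch. 2 §2 Thm. 2.6, Ch. 4 §3. [HirschDT1976]
* A. Kosinski, *Differential Manifolds* (1993), X (2.1). [Kosinski1993]
-/

open scoped Manifold ContDiff Topology
open Set Function Filter Bundle Metric Module

noncomputable section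

namespace Literature.Topology.FourManifolds

section Readings

variable {E' : Type*} [NormedAddCommGroup E'] [NormedSpace ℝ E']
  {V : Type*} [TopologicalSpace V] [ChartedSpace E' V] [IsManifold 𝓘(ℝ, E') ∞ V]
  {S : Type*} [TopologicalSpace S]
  {F : Type*} [NormedAddCommGroup F] [NormedSpace ℝ F]

/-- The vector component `TE' → E'` of the tangent bundle of the model vector space is
continuous (`TE' = E' × E'`). [folklore] -/
theorem continuous_snd_tangentBundle_self :
    Continuous (fun z : TangentBundle 𝓘(ℝ, E') E' => z.2) :=
  continuous_snd.comp (tangentBundleModelSpaceHomeomorph 𝓘(ℝ, E')).continuous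

/-- **A vector field along a map, continuous into the tangent bundle, has continuous readings**:
if `u ↦ (e u, X u)` is continuous into `TV` on `R`, then in the chart at `p` the reading
`u ↦ tangentCoordChange (e u) p (e u) (X u)` is continuous on `R ∩ e ⁻¹' (chart domain of p)`
(push-forward along the chart map, a `C^∞` map on its domain). [folklore] -/
theorem continuousOn_tangentCoordChange_apply {e : S → V} {X : S → E'} {R : Set S}
    (hX : ContinuousOn (fun u => (TotalSpace.mk' E' (e u) (X u) : TangentBundle 𝓘(ℝ, E') V)) R)
    (p : V) :
    ContinuousOn (fun u => tangentCoordChange 𝓘(ℝ, E') (e u) p (e u) (X u))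
      (R ∩ e ⁻¹' (chartAt E' p).source) := by
  have h1 := ContinuousOn.totalSpaceMk_mfderiv (I := 𝓘(ℝ, E')) (J := 𝓘(ℝ, E'))
    (f := chartAt E' p) (chartAt E' p).open_source contMDiffOn_chart (hX.mono inter_subset_left)
    (fun u hu => hu.2)
  have h2 := continuous_snd_tangentBundle_self.comp_continuousOn h1
  refine h2.congr fun u hu => ?_
  simp only [comp_apply]
  exact DFunLike.congr_fun (mfderiv_chartAt_eq_tangentCoordChange (I := 𝓘(ℝ, E')) hu.2).symm (X u)

/-- **A field of linear maps into the tangent spaces along a map, continuous into the tangent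
bundle column by column, has continuous readings** `frameIn e T p` on `e ⁻¹' (chart domain)`
(finite-dimensional source `F`). [folklore] -/
theorem continuousOn_frameIn_of_continuous_totalSpaceMk [FiniteDimensional ℝ F] {e : S → V}
    {T : S → (F →L[ℝ] E')}
    (hT : ∀ a : F, Continuous fun u => (TotalSpace.mk' E' (e u) (T u a) : TangentBundle 𝓘(ℝ, E') V))
    (p : V) : ContinuousOn (frameIn e T p) (e ⁻¹' (chartAt E' p).source) := by
  refine continuousOn_clm_apply.2 fun a => ?_
  have := continuousOn_tangentCoordChange_apply (R := univ) (hT a).continuousOn p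
  rw [univ_inter] at this
  exact this.congr fun u _ => rfl

/-- The derivative cocycle of the chart changes is invertible at the points of both domains.
[folklore] -/
theorem isInvertible_tangentCoordChange {p q y : V} (hp : y ∈ (chartAt E' p).source)
    (hq : y ∈ (chartAt E' q).source) : (tangentCoordChange 𝓘(ℝ, E') p q y).IsInvertible := by
  have hp' : y ∈ (extChartAt 𝓘(ℝ, E') p).source := by rwa [extChartAt_source]
  have hq' : y ∈ (extChartAt 𝓘(ℝ, E') q).source := by rwa [extChartAt_source]
  refine ContinuousLinearMap.IsInvertible.of_inverse (g := tangentCoordChange 𝓘(ℝ, E') q p y) ?_ ?_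
  · ext v
    simp only [ContinuousLinearMap.coe_comp, comp_apply, ContinuousLinearMap.coe_id', id_eq]
    rw [tangentCoordChange_comp ⟨⟨hq', hp'⟩, hq'⟩, tangentCoordChange_self hq']
  · ext v
    simp only [ContinuousLinearMap.coe_comp, comp_apply, ContinuousLinearMap.coe_id', id_eq]
    rw [tangentCoordChange_comp ⟨⟨hp', hq'⟩, hp'⟩, tangentCoordChange_self hp']

/-- A bijective continuous linear map between finite-dimensional spaces is invertible.
[folklore] -/
theorem isInvertible_of_bijective' {Em W : Type*} [NormedAddCommGroup Em] [NormedSpace ℝ Em]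
    [FiniteDimensional ℝ Em] [NormedAddCommGroup W] [NormedSpace ℝ W] (f : Em →L[ℝ] W)
    (hf : Bijective f) : f.IsInvertible := by
  haveI : FiniteDimensional ℝ W := Module.Finite.of_surjective (f : Em →ₗ[ℝ] W) hf.2
  exact ⟨(LinearEquiv.ofBijective (f : Em →ₗ[ℝ] W) hf).toContinuousLinearEquiv, by ext; rfl⟩

end Readings

/-! ### A frame along a map from a parallelisation -/

section Parallel

variable {E' : Type*} [NormedAddCommGroup E'] [NormedSpace ℝ E'] [FiniteDimensional ℝ E']
  {V : Type*} [TopologicalSpace V] [ChartedSpace E' V] [IsManifold 𝓘(ℝ, E') ∞ V]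
  {S : Type*} [TopologicalSpace S]

/-- **A parallelisation gives a frame along every continuous map**: if `TV` has a continuous
global framing (`IsParallelizable`), then along any continuous `e : S → V` there are linear
bijections `T u : E' → T_{e u} V`, `a ↦ Σᵢ aᵢ tᵢ (e u)` in the coordinates of a basis of `E'`,
continuous into `TV` column by column (hence in every column `T u a`). [folklore] -/
theorem exists_frame_along_of_isParallelizable (hpar : IsParallelizable 𝓘(ℝ, E') V) {e : S → V}
    (he : Continuous e) :
    ∃ T : S → (E' →L[ℝ] E'),
      (∀ a : E', Continuous fun u => (TotalSpace.mk' E' (e u) (T u a) : TangentBundle 𝓘(ℝ, E') V)) ∧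
      ∀ u, Bijective (T u) := by
  obtain ⟨t, ht, hli⟩ := hpar
  set b := Module.finBasis ℝ E' with hb
  -- the frame as linear maps
  set T : S → (E' →L[ℝ] E') := fun u =>
    ∑ i, (b.coord i).toContinuousLinearMap.smulRight (t i (e u)) with hT
  have hTa : ∀ u a, T u a = ∑ i, b.repr a i • t i (e u) := fun u a => by
    simp only [hT, FunLike.coe_sum, Finset.sum_apply,
      ContinuousLinearMap.smulRight_apply, LinearMap.coe_toContinuousLinearMap', Basis.coord_apply]
  refine ⟨T, fun a => ?_, fun u => ?_⟩
  · have := continuous_sum_smul_along (I := 𝓘(ℝ, E')) (M := V) (f := e) he Finset.univ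
      (φ := fun i _ => b.repr a i) (v := fun i u => t i (e u)) (fun i _ => continuous_const)
      (fun i _ => (ht i).comp he)
    refine this.congr fun u => ?_
    exact congrArg (TotalSpace.mk' E' (e u)) (hTa u a).symm
  · -- the image of the basis `b` is the basis `t · (e u)`
    have hbasis : LinearIndependent ℝ fun i => T u (b i) := by
      have : (fun i => T u (b i)) = fun i => t i (e u) := by
        funext i
        rw [hTa, Finset.sum_eq_single i]
        · simp
        · intro j _ hji
          simp [Basis.repr_self, hji]
        · simp
      rw [this]
      exact hli (e u)
    have hspan : Submodule.span ℝ (Set.range fun i => T u (b i)) = ⊤ :=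
      hbasis.span_eq_top_of_card_eq_finrank' (by rw [Fintype.card_fin])
    have hsurj : Surjective (T u) := by
      intro y
      have hy : y ∈ Submodule.span ℝ (Set.range fun i => T u (b i)) := by rw [hspan]; trivial
      have hle : Submodule.span ℝ (Set.range fun i => T u (b i)) ≤
          LinearMap.range (T u : E' →ₗ[ℝ] E') := by
        rw [Submodule.span_le]
        rintro _ ⟨i, rfl⟩
        exact ⟨b i, rfl⟩
      obtain ⟨x, hx⟩ := hle hy
      exact ⟨x, hx⟩
    have hinj : Injective (T u) :=
      (LinearMap.injective_iff_surjective (f := (T u : E' →ₗ[ℝ] E'))).2 hsurj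
    exact ⟨hinj, hsurj⟩

end Parallel

/-! ### Smoothing a continuous frame along a map -/

section Smoothing

variable {E' : Type*} [NormedAddCommGroup E'] [NormedSpace ℝ E']
  {V : Type*} [TopologicalSpace V] [ChartedSpace E' V] [IsManifold 𝓘(ℝ, E') ∞ V]
  {EM : Type*} [NormedAddCommGroup EM] [NormedSpace ℝ EM]
  {HM : Type*} [TopologicalSpace HM] {IM : ModelWithCorners ℝ EM HM}
  {S : Type*} [TopologicalSpace S] [ChartedSpace HM S]
  {F : Type*} [NormedAddCommGroup F] [NormedSpace ℝ F]

/-- **The derivative cocycle is smooth along a smooth map**: `u ↦ tangentCoordChange p q (e u)`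
is `C^∞` on the preimage of the intersection of the two chart domains (Mathlib's
`contDiffOn_fderiv_coord_change`, composed with the chart at `p` and with `e`). [folklore] -/
theorem contMDiffOn_tangentCoordChange_comp {e : S → V} {O : Set S}
    (he : ContMDiffOn IM 𝓘(ℝ, E') ∞ e O) (p q : V) :
    ContMDiffOn IM 𝓘(ℝ, E' →L[ℝ] E') ∞ (fun u => tangentCoordChange 𝓘(ℝ, E') p q (e u))
      (O ∩ e ⁻¹' ((chartAt E' p).source ∩ (chartAt E' q).source)) := by
  haveI : IsManifold 𝓘(ℝ, E') (∞ + 1) V := IsManifold.of_le (n := ∞) (le_of_eq rfl)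
  set i : atlas E' V := ⟨chartAt E' p, chart_mem_atlas E' p⟩
  set j : atlas E' V := ⟨chartAt E' q, chart_mem_atlas E' q⟩
  have hD := contDiffOn_fderiv_coord_change (I := 𝓘(ℝ, E')) (M := V) (n := ∞) i j
  -- the source of the coordinate change, and the chart at `p` maps into it
  have hsrc : ∀ y ∈ (chartAt E' p).source ∩ (chartAt E' q).source,
      (chartAt E' p) y ∈ ((i.1.extend 𝓘(ℝ, E')).symm ≫ j.1.extend 𝓘(ℝ, E')).source := by
    intro y hy
    rw [ModelWithCorners.extendCoordChange_source]
    refine ⟨(chartAt E' p) y, ⟨(chartAt E' p).map_source hy.1, ?_⟩, rfl⟩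
    show (chartAt E' p).symm ((chartAt E' p) y) ∈ (chartAt E' q).source
    rw [(chartAt E' p).left_inv hy.1]
    exact hy.2
  have hform : ∀ y, tangentCoordChange 𝓘(ℝ, E') p q y =
      fderivWithin ℝ (j.1.extend 𝓘(ℝ, E') ∘ (i.1.extend 𝓘(ℝ, E')).symm) (range 𝓘(ℝ, E'))
        ((chartAt E' p) y) := fun y => rfl
  have h1 : ContMDiffOn IM 𝓘(ℝ, E') ∞ (fun u => (chartAt E' p) (e u))
      (O ∩ e ⁻¹' ((chartAt E' p).source ∩ (chartAt E' q).source)) :=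
    contMDiffOn_chart.comp (he.mono inter_subset_left) fun u hu => hu.2.1
  have h2 := (hD.contMDiffOn (n := ∞)).comp h1 fun u hu => hsrc (e u) hu.2
  exact h2.congr fun u _ => hform (e u)

/-- A cut-off of a map into a normed space which is continuous on an open set is continuous.
[folklore] -/
theorem continuous_cutoff_smul' {W : Set S} (hW : IsOpen W) {G : S → F} (hG : ContinuousOn G W)
    {χ : S → ℝ} (hχ : Continuous χ) (hsupp : tsupport χ ⊆ W) : Continuous fun u => χ u • G u := by
  refine continuous_iff_continuousAt.2 fun x => ?_
  by_cases hx : x ∈ W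
  · exact ((hχ.continuousOn.smul hG).continuousAt (hW.mem_nhds hx))
  · have hxs : x ∉ tsupport χ := fun h => hx (hsupp h)
    have h0 : (fun y => χ y • G y) =ᶠ[𝓝 x] fun _ => 0 := by
      filter_upwards [notMem_tsupport_iff_eventuallyEq.1 hxs] with y hy
      simp only [hy, Pi.zero_apply, zero_smul]
    exact (continuousAt_const.congr h0.symm)

variable [FiniteDimensional ℝ EM] [IsManifold IM ∞ S] [CompactSpace S] [T2Space S]

/-- **Smoothing a continuous frame along a map from a compact manifold** (Steenrod 1951, §6.7;
Hirsch 1976, Ch. 2 §2 / Ch. 4 §3).  Let `e : S → V` be `C^∞`, `S` compact, and let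
`T u : F →L[ℝ] T_{e u} V` be a field of linear maps whose readings `frameIn e T p` are continuous
on the preimages of the chart domains and which is injective at every point.  Then there is a
field `T'` with smooth readings (`IsSmoothAlong IM e T'`) which is still injective at every point.
Construction: `T' u = Σₐ ρ a u • tangentCoordChange (p a) (e u) (e u) ∘ S a u` for a finite smooth
partition of unity `ρ` subordinate to `e ⁻¹' (chart domain of p a)` and smooth approximations `S a`
of the cut-off readings `χ a • frameIn e T (p a)`; the readings of `T'` in a chart `q` are
`Σₐ ρ a u • tangentCoordChange (p a) q (e u) ∘ S a u` (cocycle rule), smooth; on `tsupport (ρ b)`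
the reading of `T'` in the chart `p b` is uniformly close to that of `T`, and injective linear maps
form an open set. [cite: HirschDT1976, Ch. 2 §2 Thm. 2.6] -/
theorem exists_isSmoothAlong_of_continuousOn_frameIn [FiniteDimensional ℝ F] {e : S → V}
    (he : ContMDiff IM 𝓘(ℝ, E') ∞ e) {T : S → (F →L[ℝ] E')}
    (hT : ∀ p : V, ContinuousOn (frameIn e T p) (e ⁻¹' (chartAt E' p).source))
    (hTi : ∀ u, Injective (T u)) :
    ∃ T' : S → (F →L[ℝ] E'), IsSmoothAlong IM e T' ∧ ∀ u, Injective (T' u) := by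
  classical
  haveI : LocallyCompactSpace S := by infer_instance
  -- ### chart domains pulled back to `S`, a finite subcover and a subordinate partition of unity
  set p : S → V := fun a => e a with hp
  set O : S → Set S := fun a => e ⁻¹' (chartAt E' (p a)).source with hO
  have hOo : ∀ a, IsOpen (O a) := fun a => (chartAt E' (p a)).open_source.preimage he.continuous
  have hOmem : ∀ a, a ∈ O a := fun a => mem_chart_source E' (e a)
  obtain ⟨t, -, htO⟩ := isCompact_univ.elim_nhds_subcover O fun a _ => (hOo a).mem_nhds (hOmem a)
  have hcov : (univ : Set S) ⊆ ⋃ a : (t : Set S), O a := fun u _ => by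
    have := htO (mem_univ u)
    simp only [mem_iUnion, exists_prop] at this
    obtain ⟨a, ha, hu⟩ := this
    exact mem_iUnion.2 ⟨⟨a, ha⟩, hu⟩
  obtain ⟨ρ, hρ⟩ := SmoothPartitionOfUnity.exists_isSubordinate IM isClosed_univ
    (fun a : (t : Set S) => O a) (fun a => hOo a) hcov
  have hρs : ∀ a : (t : Set S), tsupport (ρ a) ⊆ O a := fun a => hρ a
  -- ### cut-offs `χ a = 1` near `tsupport (ρ a)`, supported in `O a`
  have hχ : ∀ a : (t : Set S), ∃ χ : C^∞⟮IM, S; 𝓘(ℝ), ℝ⟯,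
      (∀ u ∈ tsupport (ρ a), χ u = 1) ∧ tsupport χ ⊆ O a := by
    intro a
    obtain ⟨L, hLc, hL, hLO⟩ := exists_compact_between (isClosed_tsupport (ρ a)).isCompact (hOo a)
      (hρs a)
    obtain ⟨χ, hχ1, hχ0, -⟩ := exists_contMDiffMap_one_nhds_of_subset_interior IM
      (isClosed_tsupport (ρ a)) hL (n := (⊤ : ℕ∞))
    refine ⟨χ, fun u hu => hχ1.self_of_nhdsSet u hu, ?_⟩
    refine (closure_minimal (fun u hu => ?_) hLc.isClosed).trans hLO
    by_contra h
    exact hu (hχ0 u h)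
  choose χ hχ1 hχs using hχ
  -- ### the cut-off readings `G a` and the compact pieces
  set G : ↥(t : Set S) → S → (F →L[ℝ] E') := fun a u => χ a u • frameIn e T (p a) u with hG
  have hGc : ∀ a, Continuous (G a) := fun a =>
    continuous_cutoff_smul' (hOo a) (hT (p a)) (χ a).contMDiff.continuous (hχs a)
  have hGeq : ∀ a, ∀ u ∈ tsupport (ρ a), G a u = frameIn e T (p a) u := fun a u hu => by
    simp only [hG, hχ1 a u hu, one_smul]
  -- ### margins: in the chart `p b`, on `K b = tsupport (ρ b)`, the readings of `T` are injective
  set Inj : Set (F →L[ℝ] E') := {L | Injective L} with hInj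
  have hInjo : IsOpen Inj := ContinuousLinearMap.isOpen_injective
  have hKc : ∀ b : (t : Set S), IsCompact (tsupport (ρ b)) := fun b =>
    (isClosed_tsupport _).isCompact
  have hmargin : ∀ b : (t : Set S), ∃ m > (0 : ℝ), ∀ u ∈ tsupport (ρ b), ∀ L : F →L[ℝ] E',
      ‖L - frameIn e T (p b) u‖ < m → Injective L := by
    intro b
    have hcont : ContinuousOn (frameIn e T (p b)) (tsupport (ρ b)) := (hT (p b)).mono (hρs b)
    have himg : frameIn e T (p b) '' tsupport (ρ b) ⊆ Inj := by
      rintro _ ⟨u, hu, rfl⟩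
      show Injective (frameIn e T (p b) u)
      rw [show (frameIn e T (p b) u : F → E') = (tangentCoordChange 𝓘(ℝ, E') (e u) (p b) (e u)) ∘ T u
        from rfl]
      exact (isInvertible_tangentCoordChange (mem_chart_source E' (e u)) (hρs b hu)).injective.comp
        (hTi u)
    obtain ⟨m, hm, hthick⟩ := ((hKc b).image_of_continuousOn hcont).exists_thickening_subset_open
      hInjo himg
    refine ⟨m, hm, fun u hu L hL => ?_⟩
    have : L ∈ thickening m (frameIn e T (p b) '' tsupport (ρ b)) :=
      mem_thickening_iff.2 ⟨_, ⟨u, hu, rfl⟩, by rwa [dist_eq_norm]⟩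
    exact hthick this
  choose m hm hmInj using hmargin
  -- ### bounds for the cocycles on the compact pieces
  have hbound : ∀ a b : (t : Set S), ∃ C : ℝ, 0 < C ∧ ∀ u ∈ tsupport (ρ a) ∩ tsupport (ρ b),
      ‖tangentCoordChange 𝓘(ℝ, E') (p a) (p b) (e u)‖ ≤ C := by
    intro a b
    have hcont : ContinuousOn (fun u => tangentCoordChange 𝓘(ℝ, E') (p a) (p b) (e u))
        (tsupport (ρ a) ∩ tsupport (ρ b)) := by
      refine ((continuousOn_tangentCoordChange (I := 𝓘(ℝ, E')) (p a) (p b)).comp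
        he.continuous.continuousOn fun u hu => ?_)
      simp only [extChartAt_source]
      exact ⟨hρs a hu.1, hρs b hu.2⟩
    obtain ⟨C, hC⟩ := ((hKc a).inter_right (isClosed_tsupport _)).exists_bound_of_continuousOn hcont
    refine ⟨max C 1, lt_max_of_lt_right one_pos, fun u hu => (hC u hu).trans (le_max_left _ _)⟩
  choose C hC0 hC using hbound
  -- ### the uniform closeness `δ`
  rcases isEmpty_or_nonempty S with hS | hS
  · exact ⟨T, fun q u => (IsEmpty.false u).elim, fun u => (IsEmpty.false u).elim⟩
  haveI : Nonempty (t : Set S) := by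
    obtain ⟨u⟩ := hS
    have := htO (mem_univ u)
    simp only [mem_iUnion, exists_prop] at this
    obtain ⟨a, ha, -⟩ := this
    exact ⟨⟨a, ha⟩⟩
  set Cmax : ℝ := Finset.univ.sup' Finset.univ_nonempty
    fun ab : ↥(t : Set S) × ↥(t : Set S) => C ab.1 ab.2 with hCmax
  have hCle : ∀ a b, C a b ≤ Cmax := fun a b =>
    Finset.le_sup' (fun ab : ↥(t : Set S) × ↥(t : Set S) => C ab.1 ab.2) (Finset.mem_univ (a, b))
  have hCmax_pos : 0 < Cmax := by
    obtain ⟨a⟩ := (inferInstance : Nonempty (t : Set S))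
    exact lt_of_lt_of_le (hC0 a a) (hCle a a)
  set δ : ℝ := Finset.univ.inf' Finset.univ_nonempty fun b : ↥(t : Set S) => m b / (2 * Cmax) with hδdef
  have hδ : 0 < δ := by
    refine (Finset.lt_inf'_iff _).2 fun b _ => ?_
    exact div_pos (hm b) (by positivity)
  have hδm : ∀ b, δ ≤ m b / (2 * Cmax) := fun b =>
    Finset.inf'_le (fun b : ↥(t : Set S) => m b / (2 * Cmax)) (Finset.mem_univ b)
  -- ### the approximants `S a` and the smoothed frame `T'`
  have hSa : ∀ a : (t : Set S), ∃ Sa : C^∞⟮IM, S; 𝓘(ℝ, F →L[ℝ] E'), F →L[ℝ] E'⟯,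
      ∀ u, dist (Sa u) (G a u) < δ := fun a => by
    obtain ⟨Sa, hSa, -⟩ := (hGc a).exists_contMDiff_approx IM ⊤ continuous_const fun _ => hδ
    exact ⟨Sa, hSa⟩
  choose Sa hSa using hSa
  set T' : S → (F →L[ℝ] E') := fun u =>
    ∑ a, ρ a u • (tangentCoordChange 𝓘(ℝ, E') (p a) (e u) (e u)).comp (Sa a u) with hT'
  -- ### the readings of `T'`
  have hread : ∀ q : V, ∀ u, e u ∈ (chartAt E' q).source → frameIn e T' q u =
      ∑ a, ρ a u • (tangentCoordChange 𝓘(ℝ, E') (p a) q (e u)).comp (Sa a u) := by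
    intro q u hq
    simp only [frameIn, hT', ContinuousLinearMap.comp_finsetSum, ContinuousLinearMap.comp_smul]
    refine Finset.sum_congr rfl fun a _ => ?_
    by_cases hρa : ρ a u = 0
    · simp only [hρa, zero_smul]
    · have hua : e u ∈ (chartAt E' (p a)).source := hρs a (subset_tsupport _ hρa)
      congr 1
      rw [← ContinuousLinearMap.comp_assoc]
      congr 1
      ext v
      simp only [ContinuousLinearMap.coe_comp, comp_apply]
      exact tangentCoordChange_comp ⟨⟨by rwa [extChartAt_source], mem_extChartAt_source (e u)⟩,
        by rwa [extChartAt_source]⟩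
  refine ⟨T', fun q => ?_, fun u => ?_⟩
  · -- ### smooth readings
    have hterm : ∀ a : (t : Set S), ContMDiffOn IM 𝓘(ℝ, F →L[ℝ] E') ∞
        (fun u => ρ a u • (tangentCoordChange 𝓘(ℝ, E') (p a) q (e u)).comp (Sa a u))
        (e ⁻¹' (chartAt E' q).source) := by
      intro a u hu
      by_cases hua : u ∈ tsupport (ρ a)
      · -- near a point of `tsupport (ρ a)` everything is smooth
        have hO' : IsOpen (e ⁻¹' ((chartAt E' (p a)).source ∩ (chartAt E' q).source)) :=
          ((chartAt E' (p a)).open_source.inter (chartAt E' q).open_source).preimage he.continuous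
        have hmem : u ∈ e ⁻¹' ((chartAt E' (p a)).source ∩ (chartAt E' q).source) :=
          ⟨hρs a hua, hu⟩
        have h1 := contMDiffOn_tangentCoordChange_comp (IM := IM) (O := univ) he.contMDiffOn (p a) q
        rw [univ_inter] at h1
        have h2 : ContMDiffOn IM 𝓘(ℝ, F →L[ℝ] E') ∞
            (fun u => ρ a u • (tangentCoordChange 𝓘(ℝ, E') (p a) q (e u)).comp (Sa a u))
            (e ⁻¹' ((chartAt E' (p a)).source ∩ (chartAt E' q).source)) :=
          (ρ a).contMDiff.contMDiffOn.smul (h1.clm_comp (Sa a).contMDiff.contMDiffOn)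
        exact (h2.contMDiffAt (hO'.mem_nhds hmem)).contMDiffWithinAt
      · -- off `tsupport (ρ a)` the term vanishes near the point
        have h0 : (fun u => ρ a u • (tangentCoordChange 𝓘(ℝ, E') (p a) q (e u)).comp (Sa a u))
            =ᶠ[𝓝 u] fun _ => 0 := by
          filter_upwards [notMem_tsupport_iff_eventuallyEq.1 hua] with v hv
          simp only [hv, Pi.zero_apply, zero_smul]
        exact (contMDiffAt_const.congr_of_eventuallyEq h0).contMDiffWithinAt
    have hsum : ContMDiffOn IM 𝓘(ℝ, F →L[ℝ] E') ∞
        (fun u => ∑ a, ρ a u • (tangentCoordChange 𝓘(ℝ, E') (p a) q (e u)).comp (Sa a u))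
        (e ⁻¹' (chartAt E' q).source) :=
      contMDiffOn_finsetSum fun a _ => hterm a
    exact hsum.congr fun u hu => hread q u hu
  · -- ### injectivity: compare with `T` in the chart `p b`, `u ∈ tsupport (ρ b)`
    have hu1 : ∑ a, ρ a u = 1 := by
      have := ρ.sum_eq_one (mem_univ u)
      rwa [finsum_eq_sum_of_fintype] at this
    obtain ⟨b, hb⟩ : ∃ b : (t : Set S), u ∈ tsupport (ρ b) := by
      by_contra h
      have h' : ∀ a : (t : Set S), u ∉ tsupport (ρ a) := fun a ha => h ⟨a, ha⟩
      have : ∑ a, ρ a u = 0 := Finset.sum_eq_zero fun a _ =>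
        image_eq_zero_of_notMem_tsupport (h' a)
      rw [this] at hu1
      exact zero_ne_one hu1
    have hub : e u ∈ (chartAt E' (p b)).source := hρs b hb
    -- the reading of `T` in the chart `p b` as the same kind of sum
    have hTread : frameIn e T (p b) u =
        ∑ a, ρ a u • (tangentCoordChange 𝓘(ℝ, E') (p a) (p b) (e u)).comp (G a u) := by
      have hterm : ∀ a, ρ a u • (tangentCoordChange 𝓘(ℝ, E') (p a) (p b) (e u)).comp (G a u) =
          ρ a u • frameIn e T (p b) u := by
        intro a
        by_cases hρa : ρ a u = 0
        · simp only [hρa, zero_smul]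
        · have hua : u ∈ tsupport (ρ a) := subset_tsupport _ hρa
          rw [hGeq a u hua, tangentCoordChange_comp_frameIn T (hρs a hua) hub]
      simp only [hterm, ← Finset.sum_smul, hu1, one_smul]
    -- the difference is small
    have hdiff : ‖frameIn e T' (p b) u - frameIn e T (p b) u‖ < m b := by
      rw [hread (p b) u hub, hTread, ← Finset.sum_sub_distrib]
      have hle : ∀ a, ‖ρ a u • (tangentCoordChange 𝓘(ℝ, E') (p a) (p b) (e u)).comp (Sa a u) -
          ρ a u • (tangentCoordChange 𝓘(ℝ, E') (p a) (p b) (e u)).comp (G a u)‖ ≤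
          ρ a u * (Cmax * δ) := by
        intro a
        by_cases hρa : ρ a u = 0
        · simp only [hρa, zero_smul, sub_self, norm_zero, zero_mul, le_refl]
        · have hua : u ∈ tsupport (ρ a) := subset_tsupport _ hρa
          rw [← smul_sub, ← ContinuousLinearMap.comp_sub, norm_smul,
            Real.norm_of_nonneg (ρ.nonneg a u)]
          refine mul_le_mul_of_nonneg_left ?_ (ρ.nonneg a u)
          refine (ContinuousLinearMap.opNorm_comp_le _ _).trans ?_
          refine mul_le_mul ((hC a b u ⟨hua, hb⟩).trans (hCle a b)) ?_ (norm_nonneg _) hCmax_pos.le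
          rw [← dist_eq_norm]
          exact (hSa a u).le
      calc ‖∑ a, (ρ a u • (tangentCoordChange 𝓘(ℝ, E') (p a) (p b) (e u)).comp (Sa a u) -
              ρ a u • (tangentCoordChange 𝓘(ℝ, E') (p a) (p b) (e u)).comp (G a u))‖
          ≤ ∑ a, ρ a u * (Cmax * δ) := norm_sum_le_of_le _ fun a _ => hle a
        _ = Cmax * δ := by rw [← Finset.sum_mul, hu1, one_mul]
        _ ≤ Cmax * (m b / (2 * Cmax)) := mul_le_mul_of_nonneg_left (hδm b) hCmax_pos.le
        _ = m b / 2 := by field_simp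
        _ < m b := half_lt_self (hm b)
    have hinjread : Injective (frameIn e T' (p b) u) :=
      hmInj b u hb _ hdiff
    -- back to `T' u`
    have : (frameIn e T' (p b) u : F → E') = (tangentCoordChange 𝓘(ℝ, E') (e u) (p b) (e u)) ∘ T' u :=
      rfl
    rw [this] at hinjread
    exact hinjread.of_comp

end Smoothing

end Literature.Topology.FourManifolds
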